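import Summits.BirchSwinnertonDyer.Rank1Residual.X12.O11.RamifiedStrictDescentAtThreeDischarge
import HarnessLib

/-!
# O11 at `p = 3`, companion III — the corner K12r@3 curve by curve: (R-EU)₃ at `W` ⟺ `BSD(W, 3)` on
# the displayed sub-leaf (no `3`-torsion over `ℚ₃` for `W`, `W^{(−3)}`; `3 ∤ c_ℓ` at the bad `ℓ ≡ 1 (3)`),
# modulo {modularity, Gross–Zagier I.(7.3), GZK, Cassels}
# (cell `bsd-print-cfram`, D-0131 (2), typer seat `ty2`; sequel of p539796, p541218 and companion II)

HONEST FRAMING (cell `bsd-print-cfram`, HOME `run/shared/lean/pub/bsd-print-cfram/`): THEOREMS ONLY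
(no definition, no named fact, no axiom, no `sorry`); nothing about BSD is booked; the leaf
`Summit.BirchSwinnertonDyer.WAllCornerFRamifiedAtThree` stays OPEN. This is k7r-c4's
`…IndexIffBsdpAnyPrime` (the `p ≥ 5` corner: `(R-EU)@p ⟺ BSD(W, p)` with NO local clause) at `p = 3`,
where the two local inputs are RESTRICTIONS displayed as member-level hypotheses:

* §6 `exists_frameDataThree_of_GZK` — at every CM `W` with `3 ∣ d_K`, `r_an = 1`: a `3`-frame, `W ∼ W'`,
  an anticyclotomic `ℤ₃`-extension with topological generator, generators with their `3`-divisibility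
  levels for `W`, `W'` (GZK is the only non-constructive input; the local binders are NOT produced).
* §7 the local restrictions in member-level form: `noThreeTorsion_of_twist_model` (`W^{(−3)}(ℚ₃)[3] = 0`
  passes to every model `C • W^{(−3)}`), `away_three_of_padic` (SHARP: `W(ℚ_ℓ)[3] = 0` at every bad
  `ℓ ≠ 3` with `√−3 ∈ ℚ_ℓ`, i.e. `ℓ ≡ 1 (mod 3)` — for a CM curve `3 ∤ c_ℓ(W)` there — ⟹ the degree-one
  away input (Av)₃ over `K = ℚ(√−3)`; inert `ℓ` (incl. `2`) impose nothing).
* §8 **`bsdp_three_of_ellipticUnitIndexAtThree`**: (R-EU)₃ at `W` ⟹ `BSD(W, 3)` for every globally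
  minimal CM `W` with `3 ∣ d_K`, `r_an(W) = 1`, `W(ℚ₃)[3] = 0`, `W^{(−3)}(ℚ₃)[3] = 0`, `W(ℚ_ℓ)[3] = 0` at
  the bad `ℓ ≠ 3` with `√−3 ∈ ℚ_ℓ`, granted the four facts; **`ramifiedCMEllipticUnitIndexAtThree_of_bsdp`**: the
  converse for EVERY `W` of analytic rank `≤ 1` (no local clause; (R-ctrl)₃ is a theorem and `BSD(·, 3)`
  is isogeny-invariant under Cassels); `ramifiedCMEllipticUnitIndexAtThree_iff_bsdp`,
  `forall_bsdp_three_iff_ramifiedCMEllipticUnitIndexAtThree` (corner form).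

So the `3`-typing delivers, for the @3 block of the print cell: on the displayed sub-leaf the class
theorem is EQUIVALENT, curve by curve, to the ONE residual (R-EU)₃ = Perrin-Riou's leading-term law
for the CM zeta element at the ramified prime `3` (NOT in print; CONSTRUCTION / OPEN; nothing asserted);
off the sub-leaf (a `3`-torsion point over `ℚ₃` on `W` or `W^{(−3)}`, or `3 ∣ c_ℓ` at a bad
`ℓ ≡ 1 (mod 3)`) nothing here applies.

References: [Miller2011LMS] §1, Def. 1.1; [Cassels1965ArithmeticVIII]; [GrossZagier1986] I.(7.3);
[Darmon2004] Thm. 3.22 (GZK); [SilvermanAEC2009] III.3.1(b), VII.§1, VII.6.3, VIII.6.7; [Washington1997]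
Thm. 13.4; [GreenbergLNM1716] §2, §3 Lemma 3.3; [BurungaleKobayashiNakamuraOta2026] §1.4, Thm. 7.2
(arXiv:2608.06879; claim; preprint; shape only; `p ≥ 5` there).
-/

noncomputable section

open scoped Classical

open WeierstrassCurve NumberField IsDedekindDomain Field PowerSeries
  Literature.NumberTheory.EllipticCurves
  Literature.NumberTheory.EllipticCurves.Rank1Residual
  Literature.NumberTheory.GaloisRepresentations
  Summit.BirchSwinnertonDyer.Rank1Residual
  Summit.BirchSwinnertonDyer.Rank1Residual.Additive
  Summit.BirchSwinnertonDyer.Rank1Residual.X11b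
  Summit.BirchSwinnertonDyer.Rank1Residual.X11b.AcSelmer
  Summit.BirchSwinnertonDyer.BirchSwinnertonDyer.Theorems

namespace Summit.BirchSwinnertonDyer.Rank1Residual.X12.O11

/-! ## §6 The frame data at `3` from Gross–Zagier–Kolyvagin (everything but the local binders) -/

/-- **Frame data at `3`, granted GZK.** For `W/ℚ` globally minimal with CM, `3 ∣ d_K` and
`r_an(W) = 1`: a `3`-frame `(K, 𝔭, W', C)` (`exists_isFrameThree_of_cmRamified`) with `W ∼ W'`, an
anticyclotomic `ℤ₃`-extension of `K = ℚ(√−3)` with a topological generator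
(`ZpExtension.exists_isAnticyclotomic_holds`, unconditional in the tree), and for `W` and `W'` a
generator of Mordell–Weil modulo torsion with its exact `3`-divisibility level in `E(ℚ₃)`
(`exists_generator_with_level`; rank one for `W'` by isogeny invariance of the analytic rank). The
ONLY non-constructive input is `rank_ℤ = r_an = 1` (GZK, `hGZK`). NOT produced (they are RESTRICTIONS at
`3`, not theorems): `W(ℚ₃)[3] = 0`, `W'(ℚ₃)[3] = 0`, and the degree-one away input — k7r-c4's
`exists_frameData_of_GZK` at `3` minus Mazur's Step 1. [cite: Darmon2004, Thm. 3.22 (= Thm. 1.14) and §3.9]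
[cite: SilvermanAEC2009, Prop. VII.6.3 and Thm. VIII.6.7] [cite: Washington1997, Thm. 13.4] -/
theorem exists_frameDataThree_of_GZK (hGZK : rank_eq_analyticRank_of_analyticRank_le_one)
    (W : WeierstrassCurve ℚ) [W.IsElliptic] [W.IsGloballyMinimal]
    (hCM : W.HasCM) (hram : CMRamified W 3) (hr : W.analyticRank = 1) :
    ∃ (K : Type) (_ : Field K) (_ : NumberField K) (𝔭 : HeightOneSpectrum (𝓞 K))
      (W' : WeierstrassCurve ℚ) (_ : W'.IsElliptic) (_ : W'.IsGloballyMinimal) (C : VariableChange ℚ)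
      (κ : ZpExtension K 3) (γ : absoluteGaloisGroup K) (_ : Fact (κ.IsTopGenerator γ))
      (P : W.toAffine.Point) (n : ℕ) (P' : W'.toAffine.Point) (n' : ℕ),
      IsFrameThree W K 𝔭 W' C ∧ IsIsogenous W W' ∧ κ.IsAnticyclotomic ∧ ¬ IsOfFinAddOrder P ∧
      (∀ R : W.toAffine.Point, ∃ (k : ℤ) (T : W.toAffine.Point), IsOfFinAddOrder T ∧ R = k • P + T) ∧
      (∃ Q : (W.baseChange ℚ_[3]).toAffine.Point, (3 : ℕ) ^ n • Q = W.toPadicPoint 3 P) ∧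
      (∀ Q : (W.baseChange ℚ_[3]).toAffine.Point, (3 : ℕ) ^ (n + 1) • Q ≠ W.toPadicPoint 3 P) ∧
      ¬ IsOfFinAddOrder P' ∧
      (∀ R : W'.toAffine.Point, ∃ (k : ℤ) (T : W'.toAffine.Point),
        IsOfFinAddOrder T ∧ R = k • P' + T) ∧
      (∃ Q : (W'.baseChange ℚ_[3]).toAffine.Point, (3 : ℕ) ^ n' • Q = W'.toPadicPoint 3 P') ∧
      (∀ Q : (W'.baseChange ℚ_[3]).toAffine.Point, (3 : ℕ) ^ (n' + 1) • Q ≠ W'.toPadicPoint 3 P') := by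
  obtain ⟨K, _, _, 𝔭, W', _, _, C, hF⟩ := exists_isFrameThree_of_cmRamified W hCM hram
  have hK : IsImaginaryQuadratic K := hF.2.2.1
  have hiso : IsIsogenous W W' := isIsogenous_of_isFrameThree hF
  -- the anticyclotomic `ℤ₃`-extension and a topological generator
  obtain ⟨κ, hκ⟩ := ZpExtension.exists_isAnticyclotomic_holds (K := K) (p := 3) hK.1
    (fun w => hK.2.isComplex w)
  obtain ⟨γ, hγ⟩ := κ.exists_isTopGenerator
  -- Mordell–Weil data and levels for `W` and `W'` (GZK gives rank one)
  have hrank : W.mordellWeilRank = 1 := by rw [(hGZK W hr.le).1, hr]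
  have hr' : W'.analyticRank = 1 := by rw [← analyticRank_eq_of_isIsogenous' hiso, hr]
  have hrank' : W'.mordellWeilRank = 1 := by rw [(hGZK W' hr'.le).1, hr']
  obtain ⟨P, n, hP, hgen, hdiv, hndiv⟩ :=
    RamifiedSevenEllipticUnits.exists_generator_with_level W 3 hrank
  obtain ⟨P', n', hP', hgen', hdiv', hndiv'⟩ :=
    RamifiedSevenEllipticUnits.exists_generator_with_level W' 3 hrank'
  exact ⟨K, inferInstance, inferInstance, 𝔭, W', inferInstance, inferInstance, C, κ, γ, ⟨hγ⟩, P, n,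
    P', n', hF, hiso, hκ, hP, hgen, hdiv, hndiv, hP', hgen', hdiv', hndiv'⟩

/-! ## §7 The two local RESTRICTIONS at `3`, in member-level form -/

section Local

variable (W : WeierstrassCurve ℚ) [W.IsElliptic]

omit [W.IsElliptic] in
/-- **No `3`-torsion over `ℚ₃` is a property of the curve, not of the model**: if the twist
`W^{(−3)}` has no `ℚ₃`-point of order `3` then neither has any model `W' = C • W^{(−3)}` (the change of
variables is an isomorphism of point groups over every field, `VariableChange.pointEquiv`).
[cite: SilvermanAEC2009, III.3.1(b) and proof of III.2.5] -/
theorem noThreeTorsion_of_twist_model {W' : WeierstrassCurve ℚ} {C : VariableChange ℚ}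
    (hW' : C • W.quadraticTwist (-3 : ℚ) = W')
    (htw : ∀ Q : ((W.quadraticTwist (-3 : ℚ)).baseChange ℚ_[3]).toAffine.Point,
      (3 : ℕ) • Q = 0 → Q = 0) :
    ∀ Q : (W'.baseChange ℚ_[3]).toAffine.Point, (3 : ℕ) • Q = 0 → Q = 0 := by
  have hmodel : W'.baseChange ℚ_[3] =
      (C.map (algebraMap ℚ ℚ_[3])) • (W.quadraticTwist (-3 : ℚ)).baseChange ℚ_[3] := by
    rw [← hW', baseChange, baseChange, map_variableChange]
  rw [hmodel]
  intro Q hQ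
  have h := htw ((VariableChange.pointEquiv ((W.quadraticTwist (-3 : ℚ)).baseChange ℚ_[3])
    (C.map (algebraMap ℚ ℚ_[3]))).symm Q) (by rw [← map_nsmul, hQ, map_zero])
  exact (AddEquiv.map_eq_zero_iff _).mp h

/-- **The degree-one away input from `ℚ_ℓ`-data, SHARP form.** Let `K` be a quadratic field with
`d_K = −3` (`K = ℚ(√−3)`). If `W(ℚ_ℓ)[3] = 0` at every bad prime `ℓ ≠ 3` of `W` AT WHICH `√−3 ∈ ℚ_ℓ`
(i.e. `ℓ ≡ 1 (mod 3)`: `2` and the primes `ℓ ≡ 2 (mod 3)` are inert in `K` and impose NOTHING), then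
at every finite place `v ∤ 3` of `K` of degree one (`e = f = 1` over `ℚ`): `W_K` has good reduction at
`v` or `W(K_v)[3] = 0`. Proof: good reduction base-changes; at a bad `ℓ`, `K_v ≃ ℚ_ℓ`
(`exists_ringHom_adicCompletion_padic_of_degreeOne`) carries `√d_K = √−3 ∈ K` into `ℚ_ℓ`, and points
map injectively. For a CM curve a bad `ℓ ≠ 3` is additive and `W(ℚ_ℓ)[3] ≅ Φ_ℓ(𝔽_ℓ)[3]`, so the
hypothesis reads «`3 ∤ c_ℓ(W)` at every bad `ℓ ≡ 1 (mod 3)`». [cite: GreenbergLNM1716, §3 Lemma 3.3 and pp. 74–75]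
[cite: SilvermanAEC2009, VII.§1 and Prop. VII.5.4 (a)] [cite: Washington1997, Prop. 13.2 (splitting in quadratic fields)] -/
theorem away_three_of_padic {K : Type} [Field K] [NumberField K] (hK2 : Module.finrank ℚ K = 2)
    (hdK : NumberField.discr K = -3)
    (hℓ : ∀ (ℓ : ℕ) [Fact ℓ.Prime], ℓ ≠ 3 → (∃ y : ℚ_[ℓ], y ^ 2 = -3) → ¬ Good W ℓ →
      ∀ Q : (W.baseChange ℚ_[ℓ]).toAffine.Point, (3 : ℕ) • Q = 0 → Q = 0) :
    ∀ v : HeightOneSpectrum (𝓞 K), ((3 : ℕ) : 𝓞 K) ∉ v.asIdeal →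
      v.asIdeal.ramificationIdx (𝓞 ℚ) = 1 → v.asIdeal.inertiaDeg (𝓞 ℚ) = 1 →
      (W.baseChange K).HasGoodReductionAt v ∨
        ∀ R : ((W.baseChange K).baseChange (v.adicCompletion K)).toAffine.Point,
          (3 : ℕ) • R = 0 → R = 0 := by
  intro v hpv he hf
  -- the rational prime `ℓ` under `v`
  set v₀ : HeightOneSpectrum (𝓞 ℚ) := v.under (𝓞 ℚ) with hv₀def
  set ℓ : ℕ := (Rat.HeightOneSpectrum.primesEquiv v₀ : ℕ) with hℓdef
  haveI hℓP : Fact ℓ.Prime := ⟨(Rat.HeightOneSpectrum.primesEquiv v₀).2⟩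
  have hv₀ : v.under (𝓞 ℚ) = ratPlace ℓ := by
    rw [ratPlace, ← hv₀def]
    exact ((Rat.HeightOneSpectrum.primesEquiv (R := 𝓞 ℚ)).symm_apply_apply v₀).symm
  have hℓv : ((ℓ : ℕ) : 𝓞 K) ∈ v.asIdeal := mem_of_under_eq_ratPlace hv₀
  haveI : v.asIdeal.LiesOver v₀.asIdeal := ⟨rfl⟩
  have hℓ3 : ℓ ≠ 3 := by
    intro h
    rw [h] at hℓv
    exact hpv hℓv
  by_cases hgood : Good W ℓ
  · left
    have hgood' : W.HasGoodReductionAt v₀ :=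
      (hasGoodReductionAtPrime_primesEquiv_iff_holds W v₀ ℓ rfl).mp hgood
    exact hasGoodReductionAt_baseChange_of_hasGoodReductionAt_rat W v₀ v hgood'
  · right
    obtain ⟨e⟩ := AcSelmer.exists_ringHom_adicCompletion_padic_of_degreeOne (p := ℓ) v hℓv he hf
    -- `√−3 ∈ K ↪ K_v ≃ ℚ_ℓ`
    obtain ⟨θ, -, hθsq⟩ := exists_sq_eq_discr_not_mem_range K hK2
    have hθ3 : θ ^ 2 = -3 := by rw [hθsq, hdK]; simp
    have hy : ∃ y : ℚ_[ℓ], y ^ 2 = -3 :=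
      ⟨e (algebraMap K (v.adicCompletion K) θ), by
        rw [← map_pow, ← map_pow, hθ3, map_neg, map_neg, map_ofNat, map_ofNat]⟩
    exact noPTorsion_baseChange_adicCompletion_of_ringHom W 3 v e (hℓ ℓ hℓ3 hy hgood)

end Local

/-! ## §8 (R-EU)₃ ⟹ `BSD(W, 3)` at the member level, and the converse -/

section Leaf

variable {W : WeierstrassCurve ℚ} [W.IsElliptic] [W.IsGloballyMinimal]

/-- **(R-EU)₃ at `W` ⟹ `BSD(W, 3)`** for every globally minimal CM curve `W/ℚ` with `3 ∣ d_K` and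
analytic rank one ON THE DISPLAYED SUB-LEAF — `W(ℚ₃)[3] = 0`, `W^{(−3)}(ℚ₃)[3] = 0`, and
`W(ℚ_ℓ)[3] = 0` (i.e. `3 ∤ c_ℓ`) at every bad `ℓ ≠ 3` with `√−3 ∈ ℚ_ℓ` (`ℓ ≡ 1 (mod 3)`) — granted
modularity (`hmod`), Gross–Zagier
I.(7.3) (`hGZ`), GZK (`hGZK`) and Cassels (`hCassels`): the frame data of §6 and the two transports of
§7 fed to `bsdp_three_of_ramifiedCMEllipticUnitIndexAtThree` ((R-tors)₃ ⟸ GZK, (R-ctrl)₃ outright).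
So on this sub-leaf of K12r@3 the ONE residual is (R-EU)₃ (CONSTRUCTION / OPEN; nothing asserted).
[cite: Miller2011LMS, §1 and Def. 1.1 (arXiv:1010.2431 p. 3)] [cite: GrossZagier1986, Thm. I.(7.3)]
[cite: Cassels1965ArithmeticVIII] [cite: BurungaleKobayashiNakamuraOta2026, §1.4 (arXiv:2608.06879 p. 8) (claim; preprint; shape only)] -/
theorem bsdp_three_of_ellipticUnitIndexAtThree (hmod : hasEntireLFunction_rat)
    (hGZ : GrossZagier1986_thm_I_7_3) (hGZK : rank_eq_analyticRank_of_analyticRank_le_one)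
    (hCassels : bsdRHS_eq_of_isIsogenous) (hCM : W.HasCM) (hram : CMRamified W 3)
    (hr : W.analyticRank = 1)
    (htors : ∀ Q : (W.baseChange ℚ_[3]).toAffine.Point, (3 : ℕ) • Q = 0 → Q = 0)
    (htw : ∀ Q : ((W.quadraticTwist (-3 : ℚ)).baseChange ℚ_[3]).toAffine.Point,
      (3 : ℕ) • Q = 0 → Q = 0)
    (hℓ : ∀ (ℓ : ℕ) [Fact ℓ.Prime], ℓ ≠ 3 → (∃ y : ℚ_[ℓ], y ^ 2 = -3) → ¬ Good W ℓ →
      ∀ Q : (W.baseChange ℚ_[ℓ]).toAffine.Point, (3 : ℕ) • Q = 0 → Q = 0)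
    (h3 : RamifiedCMEllipticUnitIndexAtThree W) : BSDp W 3 := by
  obtain ⟨K, _, _, 𝔭, W', _, _, C, κ, γ, _, P, n, P', n', hF, -, hκ, hP, hgen, hdiv, hndiv, hP', hgen',
    hdiv', hndiv'⟩ := exists_frameDataThree_of_GZK hGZK W hCM hram hr
  exact bsdp_three_of_ramifiedCMEllipticUnitIndexAtThree hmod hGZ hGZK hCassels h3 hF hr hκ γ hP hgen
    htors hdiv hndiv hP' hgen' (noThreeTorsion_of_twist_model W hF.twist_eq htw) hdiv' hndiv'
    (away_three_of_padic W hF.2.2.1.1 hF.discr_eq hℓ)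

omit [W.IsGloballyMinimal] in
/-- **(R-ctrl)₃ ∧ BSD(W, 3) ∧ BSD(W', 3) ⟹ (R-EU)₃** at `W` (pure arithmetic: the DISCHARGED index
theorem `StrictSha.strictSelmerIndexAt_holds` at `3` for `W` and `W'`, and `BSDp` pins
`ord₃ #Ш[3^∞] = ord₃ #Ш_an`) — k7r-c2's `ellipticUnitIndexAt_of_strictControlAt_of_bsdp` at `3`.
[cite: Miller2011LMS, Def. 1.1 (arXiv:1010.2431 p. 3)] [cite: GreenbergLNM1716, §2 (pp. 62–63)] -/
theorem ellipticUnitIndexAtThree_of_strictControlAtThree_of_bsdp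
    (h2 : RamifiedCMStrictControlAtThree W) (hB : BSDp W 3)
    (hB' : ∀ (K : Type) [Field K] [NumberField K] (𝔭 : HeightOneSpectrum (𝓞 K))
      (W' : WeierstrassCurve ℚ) [W'.IsElliptic] [W'.IsGloballyMinimal] (C : VariableChange ℚ),
      IsFrameThree W K 𝔭 W' C → BSDp W' 3) :
    RamifiedCMEllipticUnitIndexAtThree W := by
  intro K _ _ 𝔭 W' _ _ C hF hr κ hκ γ _ P n P' n' hP hgen htors hdiv hndiv hP' hgen' htors' hdiv'
    hndiv' hv q q' hq hq' n₀ hchar hfinT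
  obtain ⟨-, hfin, q₀, hq₀, hvW⟩ := hB
  obtain ⟨-, hfin', q₀', hq₀', hvW'⟩ := hB' K 𝔭 W' C hF
  haveI := hfin
  haveI := hfin'
  have e : q = q₀ := RamifiedSevenEllipticUnits.ratCast_shaAn_unique hq hq₀
  have e' : q' = q₀' := RamifiedSevenEllipticUnits.ratCast_shaAn_unique hq' hq₀'
  subst e e'
  have hctrl := h2 K 𝔭 W' C hF hr κ hκ γ P n P' n' hP hgen htors hdiv hndiv hP' hgen' htors' hdiv'
    hndiv' hv n₀ hchar hfinT
  have hI := (StrictSha.strictSelmerIndexAt_holds W 3).padicValNat_card_eq hP hgen htors hdiv hndiv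
  have hI' := (StrictSha.strictSelmerIndexAt_holds W' 3).padicValNat_card_eq hP' hgen' htors' hdiv'
    hndiv'
  rw [hI, hI', Nat.cast_add, Nat.cast_add] at hctrl
  rw [hvW, hvW']
  linarith

/-- **`BSD(W, 3)` ⟹ (R-EU)₃ at `W`** for every globally minimal `W/ℚ` of analytic rank `≤ 1`,
granted Cassels (`hCassels`), modularity (`hmod`) and GZK (`hGZK`): `BSD(·, 3)` is then an isogeny
invariant (`Wuthrich2014.bsdp_of_isIsogenous`; the frame twin is isogenous, `isIsogenous_of_isFrameThree`)
and (R-ctrl)₃ is a theorem (`ramifiedCMStrictControlAtThree_holds`). Vacuous unless `W` is CM with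
`3 ∣ d_K`; NO local hypothesis is needed in this direction. [cite: Cassels1965ArithmeticVIII]
[cite: Miller2011LMS, Def. 1.1 (arXiv:1010.2431 p. 3)] -/
theorem ramifiedCMEllipticUnitIndexAtThree_of_bsdp (hCassels : bsdRHS_eq_of_isIsogenous)
    (hmod : hasEntireLFunction_rat) (hGZK : rank_eq_analyticRank_of_analyticRank_le_one)
    (hr : W.analyticRank ≤ 1) (hB : BSDp W 3) : RamifiedCMEllipticUnitIndexAtThree W := by
  have hfin : Finite W.sha := (hGZK W hr).2
  have hlead : W.leadingLCoeff ≠ 0 := WeierstrassCurve.leadingLCoeff_ne_zero_holds (hmod W)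
  exact ellipticUnitIndexAtThree_of_strictControlAtThree_of_bsdp
    (ramifiedCMStrictControlAtThree_holds W) hB fun K _ _ 𝔭 W' _ _ C hF =>
      Wuthrich2014.bsdp_of_isIsogenous hCassels (isIsogenous_of_isFrameThree hF).symm_of_charZero
        hfin hlead hB

/-- **(R-EU)₃ at `W` ⟺ `BSD(W, 3)`** for every globally minimal CM curve `W/ℚ` of analytic rank one
with `3 ∣ d_K` ON THE DISPLAYED SUB-LEAF (`W(ℚ₃)[3] = 0`, `W^{(−3)}(ℚ₃)[3] = 0`, `W(ℚ_ℓ)[3] = 0` at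
the bad `ℓ ≡ 1 (mod 3)`), modulo exactly modularity, Gross–Zagier I.(7.3), GZK and Cassels: there the
K12r@3 cell carries ONE residual statement, the elliptic-unit index law (R-EU)₃ — Perrin-Riou's
conjecture for the CM zeta element at the ramified prime `3`; CONSTRUCTION / OPEN, nothing asserted.
(k7r-c4's `ramifiedCMEllipticUnitIndexAt_iff_bsdp` is the `p ≥ 5` statement, with no local clause.)
[cite: Miller2011LMS, §1 and Def. 1.1 (arXiv:1010.2431 p. 3)]
[cite: BurungaleKobayashiNakamuraOta2026, §1.4 and Thm. 7.2 (arXiv:2608.06879 pp. 8, 40) (claim; preprint; shape only; `p ≥ 5` there)] -/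
theorem ramifiedCMEllipticUnitIndexAtThree_iff_bsdp (hmod : hasEntireLFunction_rat)
    (hGZ : GrossZagier1986_thm_I_7_3) (hGZK : rank_eq_analyticRank_of_analyticRank_le_one)
    (hCassels : bsdRHS_eq_of_isIsogenous) (hCM : W.HasCM) (hram : CMRamified W 3)
    (hr : W.analyticRank = 1)
    (htors : ∀ Q : (W.baseChange ℚ_[3]).toAffine.Point, (3 : ℕ) • Q = 0 → Q = 0)
    (htw : ∀ Q : ((W.quadraticTwist (-3 : ℚ)).baseChange ℚ_[3]).toAffine.Point,
      (3 : ℕ) • Q = 0 → Q = 0)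
    (hℓ : ∀ (ℓ : ℕ) [Fact ℓ.Prime], ℓ ≠ 3 → (∃ y : ℚ_[ℓ], y ^ 2 = -3) → ¬ Good W ℓ →
      ∀ Q : (W.baseChange ℚ_[ℓ]).toAffine.Point, (3 : ℕ) • Q = 0 → Q = 0) :
    RamifiedCMEllipticUnitIndexAtThree W ↔ BSDp W 3 :=
  ⟨bsdp_three_of_ellipticUnitIndexAtThree hmod hGZ hGZK hCassels hCM hram hr htors htw hℓ,
    ramifiedCMEllipticUnitIndexAtThree_of_bsdp hCassels hmod hGZK hr.le⟩

/-- **Corner form at `3`.** Granted the four named facts: for every globally minimal CM curve `W/ℚ`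
of analytic rank one with `3 ∣ d_K` on the displayed sub-leaf, `BSD(W, 3)` holds iff (R-EU)₃ holds at
`W` — the K12r@3 corner, curve by curve, modulo the two local restrictions. (O11's `p ≥ 5` corner form
is k7r-c4's `forall_bsdp_iff_ramifiedCMEllipticUnitIndexAt`.)
[cite: Miller2011LMS, §1 and Def. 1.1 (arXiv:1010.2431 p. 3)] -/
theorem forall_bsdp_three_iff_ramifiedCMEllipticUnitIndexAtThree (hmod : hasEntireLFunction_rat)
    (hGZ : GrossZagier1986_thm_I_7_3) (hGZK : rank_eq_analyticRank_of_analyticRank_le_one)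
    (hCassels : bsdRHS_eq_of_isIsogenous) :
    ∀ (W : WeierstrassCurve ℚ) [W.IsElliptic] [W.IsGloballyMinimal],
      W.HasCM → CMRamified W 3 → W.analyticRank = 1 →
      (∀ Q : (W.baseChange ℚ_[3]).toAffine.Point, (3 : ℕ) • Q = 0 → Q = 0) →
      (∀ Q : ((W.quadraticTwist (-3 : ℚ)).baseChange ℚ_[3]).toAffine.Point,
        (3 : ℕ) • Q = 0 → Q = 0) →
      (∀ (ℓ : ℕ) [Fact ℓ.Prime], ℓ ≠ 3 → (∃ y : ℚ_[ℓ], y ^ 2 = -3) → ¬ Good W ℓ →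
        ∀ Q : (W.baseChange ℚ_[ℓ]).toAffine.Point, (3 : ℕ) • Q = 0 → Q = 0) →
        (BSDp W 3 ↔ RamifiedCMEllipticUnitIndexAtThree W) :=
  fun _ _ _ hCM hram hr htors htw hℓ ↦
    (ramifiedCMEllipticUnitIndexAtThree_iff_bsdp hmod hGZ hGZK hCassels hCM hram hr htors htw hℓ).symm

end Leaf

/-! ## §9 Glue for a split of the route crux `CMRamifiedThreeBSD` (stmt-BirchSwinnertonDyer-20371) along
## the displayed sub-leaf (planner's call, D-0059; typed here so that a split's glue closes BY NAME) -/

section Glue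

/-- **Glue: (E) the elliptic-unit index law at `3` on the leaf ∧ (X) `BSD(·, 3)` on the complement of
the displayed sub-leaf ⟹ the route crux C1 `CMRamifiedThreeBSD` (its body VERBATIM as filed in
`Theses/PrintCFram.lean`: the four facts as antecedents, then `∀ W, HasCM → r_an = 1 → CMRamified W 3
→ BSDp W 3`).** (E) `∀ W, W.HasCM → W.analyticRank = 1 → CMRamified W 3 →
RamifiedCMEllipticUnitIndexAtThree W` is the O11@3 residual (vacuous off the sub-leaf by its binders);
(X) asks `BSD(W, 3)` for the members with a `3`-torsion point over `ℚ₃` on `W` or `W^{(−3)}` or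
`3 ∣ c_ℓ` at a bad `ℓ ≡ 1 (mod 3)` — certificate / family territory, no typing offered here. Proof:
case split on the three member-level conditions; on the sub-leaf `bsdp_three_of_ellipticUnitIndexAtThree`.
Nothing is asserted about (E) or (X). [cite: Miller2011LMS, §1 and Def. 1.1 (arXiv:1010.2431 p. 3)] -/
theorem cmRamifiedThreeBSD_of_indexLaw_of_exceptions
    (hE : ∀ (W : WeierstrassCurve ℚ) [W.IsElliptic] [W.IsGloballyMinimal],
      W.HasCM → W.analyticRank = 1 → CMRamified W 3 → RamifiedCMEllipticUnitIndexAtThree W)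
    (hX : hasEntireLFunction_rat → GrossZagier1986_thm_I_7_3 →
      rank_eq_analyticRank_of_analyticRank_le_one → bsdRHS_eq_of_isIsogenous →
      ∀ (W : WeierstrassCurve ℚ) [W.IsElliptic] [W.IsGloballyMinimal],
        W.HasCM → W.analyticRank = 1 → CMRamified W 3 →
        ¬ ((∀ Q : (W.baseChange ℚ_[3]).toAffine.Point, (3 : ℕ) • Q = 0 → Q = 0) ∧
            (∀ Q : ((W.quadraticTwist (-3 : ℚ)).baseChange ℚ_[3]).toAffine.Point,
              (3 : ℕ) • Q = 0 → Q = 0) ∧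
            (∀ (ℓ : ℕ) [Fact ℓ.Prime], ℓ ≠ 3 → (∃ y : ℚ_[ℓ], y ^ 2 = -3) → ¬ Good W ℓ →
              ∀ Q : (W.baseChange ℚ_[ℓ]).toAffine.Point, (3 : ℕ) • Q = 0 → Q = 0)) →
        BSDp W 3) :
    hasEntireLFunction_rat → GrossZagier1986_thm_I_7_3 →
      rank_eq_analyticRank_of_analyticRank_le_one → bsdRHS_eq_of_isIsogenous →
      ∀ (W : WeierstrassCurve ℚ) [W.IsElliptic] [W.IsGloballyMinimal],
        W.HasCM → W.analyticRank = 1 → CMRamified W 3 → BSDp W 3 := by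
  intro hmod hGZ hGZK hCassels W _ _ hCM hr hram
  by_cases h : (∀ Q : (W.baseChange ℚ_[3]).toAffine.Point, (3 : ℕ) • Q = 0 → Q = 0) ∧
      (∀ Q : ((W.quadraticTwist (-3 : ℚ)).baseChange ℚ_[3]).toAffine.Point,
        (3 : ℕ) • Q = 0 → Q = 0) ∧
      (∀ (ℓ : ℕ) [Fact ℓ.Prime], ℓ ≠ 3 → (∃ y : ℚ_[ℓ], y ^ 2 = -3) → ¬ Good W ℓ →
        ∀ Q : (W.baseChange ℚ_[ℓ]).toAffine.Point, (3 : ℕ) • Q = 0 → Q = 0)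
  · exact bsdp_three_of_ellipticUnitIndexAtThree hmod hGZ hGZK hCassels hCM hram hr h.1 h.2.1
      (fun ℓ _ ↦ h.2.2 ℓ) (hE W hCM hr hram)
  · exact hX hmod hGZ hGZK hCassels W hCM hr hram h

end Glue

end Summit.BirchSwinnertonDyer.Rank1Residual.X12.O11

end
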